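import Summits.BirchSwinnertonDyer.BirchSwinnertonDyer.Theorems.ByReductionTypeAtTwoMultTowerSplitOrderCount
import HarnessLib

/-!
# Route `ByReductionTypeAtTwo`, crux `MultUpperHalfAtTwo` (item stmt-BirchSwinnertonDyer-19922), TOWER road, the
# SPLIT rows: KERNEL BRICK S4 — the ORDER bound at a split `2`:
# `#𝒦_{v,n}[2^∞] ≤ 2^{k}` whenever `ord₂(log₂ q_E) ≤ k + 2` — the projection of hSP the split doors consume, PROVED

HONEST FRAMING (cell `bsd-2adic`, run/shared/lean/pub/bsd-2adic/, seat `bsd-2adic-mult` GEN 13, HUMAN RULINGS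
D-0036 / D-0054 / D-0074): theorems only (no definition, no named fact, no `sorry`); closes nothing by itself (the split
tower class files keep their other displayed binders); nothing booked; BSD is not proved by any of this. This file
PROVES, in the kernel, the statement the split TOWER doors of item 19922 take from the PRINT named fact
`Greenberg1999.sec3_natCard_localTowerKerPrimary_splitMultiplicative_rat` (Greenberg, LNM 1716, §3 pp. 92–93,
`|ker(r_{v_n})| ∼ log_p(N q_E)/2p[…]`, R342 PRINT-by-name) through `MultTowerCert.atTwo_le_pow_of_split`:
for `W/ℚ` with a Tate datum `Dq` at `2` (split multiplicative), `log₂ q_E ≠ 0` and `ord₂(log₂ q_E) ≤ k + 2`,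
EVERY cyclotomic `κ`, `v ∋ 2` and EVERY layer `n`: the local tower kernel `𝒦_{v,n}[2^∞]` is finite of order
`≤ 2^k` — hence so is its `2`-torsion (`atTwo_le_pow_of_split_kernel`, the door's slot VERBATIM minus `hSP`). It is an
UPPER BOUND (the print's EQUALITY needs local reciprocity and is not claimed); it needs NO class field axiom. Assembly:
BRICK S3 (untwisted uniformisation with `j`-clause, `e(q_v) = Dq.q`), BRICK S1 (`ord₂ log₂ q_E = w + 2` ⇒ depth `w` of
the Tate unit), BRICK S4b (the count `#(M_∞/(g−1)M_∞)[2^∞] ≤ 2^w`), the tree's local inflation–restriction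
`WeierstrassCurve.finite_localTowerKerPrimary_and_card_le` (`𝒦_{v,n}[2^∞] ↪ (M_∞/(g−1)M_∞)[2^∞]`).

* `finite_and_natCard_localTowerKerPrimary_le_pow_splitTwo` — **`Finite 𝒦_{v,n}[2^∞] ∧ #𝒦_{v,n}[2^∞] ≤ 2^k`**;
* `atTwo_le_pow_of_split_kernel` — the `2`-torsion projection, = `MultTowerCert.atTwo_le_pow_of_split` WITHOUT `hSP`.

References: R. Greenberg, LNM 1716 (1999), §3 pp. 85–93; J. Silverman, GTM 151, V.3–V.5; J. Neukirch, *ANT* IV (3.5);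
cell memos NOTE-SP1ONE.md §5, SCOPE-hNS2one-kernel-GEN8.md.
-/

set_option autoImplicit false
-- the Theorems namespace of this sub repeats the summit name by design (D-0017 nested layout: Summit.<S>.<Sub>)
set_option linter.dupNamespace false

noncomputable section

open scoped Classical

namespace Summit.BirchSwinnertonDyer.BirchSwinnertonDyer.Theorems.MultTowerSplitOrder

open NumberField IsDedekindDomain Field WeierstrassCurve PadicInt Rat.HeightOneSpectrum
  Literature.NumberTheory.EllipticCurves Literature.NumberTheory.EllipticCurves.ResKernel
  Literature.NumberTheory.GaloisRepresentations
  Summit.BirchSwinnertonDyer.BirchSwinnertonDyer.Theorems.MultTowerNS2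

variable {κ : ZpExtension ℚ 2}

/-! ### The kernel theorems -/

/-- **The ORDER bound at a split `2`, PROVED**: for `W/ℚ` elliptic with a Tate datum `Dq` at `2` (split multiplicative
reduction at `2`, `q_E = Dq.q`), `log₂ q_E ≠ 0` and `ord₂(log₂ q_E) ≤ k + 2`, the local tower kernel `𝒦_{v,n}[2^∞]`
(`W.localTowerKerPrimary κ ℚ_v n`) is finite of order at most `2^k`, for every cyclotomic `κ`, every `v ∋ 2` and every
layer `n`. The PRINT fact hSP (`Greenberg1999.sec3_natCard_localTowerKerPrimary_splitMultiplicative_rat`) asserts the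
ORDER is exactly `2^{ord₂ log₂ q_E − 2}`; this is its upper half, now a theorem.
[cite: GreenbergLNM1716, §3, between Prop. 3.6 and Prop. 3.7 (PDF pp. 92–93)] [cite: SilvermanATAEC1994, Thm. V.3.1, V.5.3]
[cite: NeukirchANT1999, Ch. IV (3.5)] -/
theorem finite_and_natCard_localTowerKerPrimary_le_pow_splitTwo (W : WeierstrassCurve ℚ) [W.IsElliptic]
    (Dq : TateParameterData W 2) (hlog : padicLog 2 Dq.q ≠ 0) {k : ℕ}
    (hk : (padicLog 2 Dq.q).valuation ≤ (k : ℤ) + 2) (κ : ZpExtension ℚ 2) (hκ : κ.IsCyclotomic)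
    (v : HeightOneSpectrum (𝓞 ℚ)) (hv : ((2 : ℕ) : 𝓞 ℚ) ∈ v.asIdeal) (n : ℕ) :
    Finite (W.localTowerKerPrimary κ (v.adicCompletion ℚ) n) ∧
      Nat.card (W.localTowerKerPrimary κ (v.adicCompletion ℚ) n) ≤ 2 ^ k := by
  -- the uniformisation at `v` and the identification with `Dq.q`
  have hsplitv := hasSplitMultiplicativeReductionAt_of_atPrime W v hv Dq.split
  obtain ⟨q, Φ, hq0, hq1, hqj, hsurj, hker, hequiv⟩ := exists_tateUniformisation_tateJ W v hsplitv
  obtain ⟨e, he⟩ := exists_ringEquiv_tateParameter 2 v hv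
  have heq : e q = Dq.q := he W q hq0 hq1 hqj Dq
  -- `Dq.q = 2^k' u`, `u` of depth `w ≤ k`
  obtain ⟨k', u, hqu⟩ := exists_eq_two_pow_mul_units Dq.q_ne_zero Dq.norm_q_lt_one
  obtain ⟨s, hs2, hsk, hus⟩ := exists_depth_of_padicLog hqu hlog hk
  obtain ⟨w, rfl⟩ : ∃ w, s = w + 2 := ⟨s - 2, by omega⟩
  have hu' : ‖(u : ℤ_[2]) ^ 2 - 1‖ = (2 : ℝ) ^ (-((w : ℤ) + 3)) := by
    rw [hus, show ((w + 2 : ℕ) : ℤ) + 1 = (w : ℤ) + 3 by push_cast; ring]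
  have hq : e q = (2 : ℚ_[2]) ^ k' * ((u : ℤ_[2]) : ℚ_[2]) := by rw [heq, hqu]
  -- equivariance in value form
  have hequiv' : ∀ (σ : absoluteGaloisGroup (v.adicCompletion ℚ)) (w w' : (AlgebraicClosure (v.adicCompletion ℚ))ˣ),
      (w' : AlgebraicClosure (v.adicCompletion ℚ)) = σ • (w : AlgebraicClosure (v.adicCompletion ℚ)) →
        σ • Φ (Additive.ofMul w) = Φ (Additive.ofMul w') := by
    intro σ w w' h
    have hw' : w' = Units.map (absoluteGaloisGroup.toAlgEquiv (v.adicCompletion ℚ) σ :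
        AlgebraicClosure (v.adicCompletion ℚ) →* AlgebraicClosure (v.adicCompletion ℚ)) w := Units.ext h
    rw [hw']
    exact hequiv σ w
  -- a topological generator and the count
  obtain ⟨g, hgn, hgen⟩ := ZpExtension.exists_mem_localSubgroup_generate κ (v.adicCompletion ℚ) n
  obtain ⟨hfinT, hcardT⟩ := finite_primaryComponent_coinvariants_and_card_le hκ v hv hsurj hker hequiv' hq0 hq1 e hq hu'
    n hgn hgen
  haveI := hfinT
  obtain ⟨hfin, hcard⟩ := finite_localTowerKerPrimary_and_card_le W κ (v.adicCompletion ℚ) n hgn hgen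
  refine ⟨hfin, hcard.trans (hcardT.trans ?_)⟩
  exact Nat.pow_le_pow_right (by norm_num) (by omega)

/-- **`h2` at a SPLIT multiplicative `2` — KERNEL**: the hypothesis `h2 = #𝒦_{v,j'}[2] ≤ 2^k` of the tower gap
certificates, i.e. the statement `MultTowerCert.atTwo_le_pow_of_split` derives from the PRINT named fact hSP, proved
WITHOUT hSP: same signature minus `hSP` (and minus global minimality). [cite: GreenbergLNM1716, §3, between Prop. 3.6
and Prop. 3.7 (PDF pp. 92–93)] -/
theorem atTwo_le_pow_of_split_kernel (W : WeierstrassCurve ℚ) [W.IsElliptic]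
    (Dq : TateParameterData W 2) (hlog : padicLog 2 Dq.q ≠ 0) {k : ℕ}
    (hk : (padicLog 2 Dq.q).valuation ≤ (k : ℤ) + (padicValNat 2 (2 * 2) : ℤ)) (n : ℕ) :
    ∀ κ : ZpExtension ℚ 2, κ.IsCyclotomic → ∀ v : HeightOneSpectrum (𝓞 ℚ), ((2 : ℕ) : 𝓞 ℚ) ∈ v.asIdeal →
      Finite {x : W.localTowerKerPrimary κ (v.adicCompletion ℚ) n // 2 • x = 0} ∧
        Nat.card {x : W.localTowerKerPrimary κ (v.adicCompletion ℚ) n // 2 • x = 0} ≤ 2 ^ k := by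
  intro κ hκ v hv
  have h4 : padicValNat 2 (2 * 2) = 2 := by
    have : (2 * 2 : ℕ) = 2 ^ 2 := by norm_num
    rw [this, padicValNat.prime_pow]
  rw [h4] at hk
  obtain ⟨hfin, hcard⟩ := finite_and_natCard_localTowerKerPrimary_le_pow_splitTwo W Dq hlog (by exact_mod_cast hk) κ hκ v hv n
  haveI := hfin
  exact ⟨Finite.of_injective _ Subtype.val_injective,
    (Nat.card_le_card_of_injective _ Subtype.val_injective).trans hcard⟩

end Summit.BirchSwinnertonDyer.BirchSwinnertonDyer.Theorems.MultTowerSplitOrder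

end
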